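import Summits.ValiantsHypothesis.ValiantsHypothesis.Theses.SchenstedIndex

/-!
# Sketch — first lemmas of the crux ideas for `OneFactorisationBandLimit` (K1), round 1, ideator 1

Crux item stmt-ValiantsHypothesis-16081, route-ValiantsHypothesis-SchenstedIndex.
Only SIGNATURES are the deliverable here (crux-ideate: "First lemma … must elaborate"); proofs are
`sorry` except where they are pure bookkeeping.
-/

open scoped BigOperators

namespace Summit.ValiantsHypothesis.ValiantsHypothesis.Cruxes.OneFactorisationBandLimit.IdeasR1K1

open Summit.ValiantsHypothesis.ValiantsHypothesis.Theses.SchenstedIndex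
open Literature.Computability.AlgebraicComplexity

/-! ## The route's objects, named (verbatim copies of the crux body; cf. CensusSketch.lean) -/

abbrev Slot (t m : ℕ) := Fin t × Fin m × Fin m

abbrev SP (t m : ℕ) :=
  {π : Finpartition (Finset.univ : Finset (Slot t m)) // ∀ B ∈ π.parts, B.card = m}

/-- the 1-factorisation indicator `1_OF(t,m)` -/
noncomputable def indOF (t m : ℕ) : SP t m → ℂ := fun π =>
  if (∀ B ∈ π.1.parts, (B.image fun s => s.2.1).card = m ∧ (B.image fun s => s.2.2).card = m)
  then (1 : ℂ) else 0

/-- the block-cycle vector `v_X` of a slot matrix -/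
noncomputable def blockCycle (t m : ℕ) (X : Matrix (Slot t m) (Slot t m) ℂ) : SP t m → ℂ := fun π =>
  ∏ B ∈ π.1.parts, ∑ q : Fin m ≃ ↥B, ∏ i : Fin m, X (q i).1 (q (finRotate m i)).1

/-- `span_n(t,m)` -/
noncomputable def spanN (t m n : ℕ) : Submodule ℂ (SP t m → ℂ) :=
  Submodule.span ℂ (Set.range fun X : {X : Matrix (Slot t m) (Slot t m) ℂ // X.rank ≤ n} =>
    blockCycle t m X.1)

/-- separation at `(t,m,n)`: `1_OF(t,m) ∉ span_n(t,m)` -/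
def Sep (t m n : ℕ) : Prop := indOF t m ∉ spanN t m n

theorem K1_iff :
    OneFactorisationBandLimit ↔
      ∀ c m₀ : ℕ, ∃ m : ℕ, m₀ ≤ m ∧ 1 ≤ m ∧
        ∀ e : ℕ, m + e ≤ 2 ^ ((Nat.log 2 m + c) ^ c) → ∃ t : ℕ, Sep t m (m + e) :=
  Iff.rfl

/-! ## Idea A (`polystable-invariant-type`) — first lemmas -/

/-- the generic `m × m` trace power `tr(X^m)` in the permanent's own `m²` variables
(the unpadded easy point at width `n = m`; `X̄_m = closure(GL_{m²} · tr X^m)`). -/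
noncomputable def powTraceSame (m : ℕ) : MvPolynomial (Fin m × Fin m) ℂ :=
  ((Matrix.of fun i j => (MvPolynomial.X (i, j) : MvPolynomial (Fin m × Fin m) ℂ)) ^ m).trace

/-- FIRST LEMMA (A1, GIT form): for `m ≥ 3` the permanent is not a degeneration of the trace
power of the generic `m × m` matrix: `per_m ∉ closure(GL_{m²} · tr(X^m))`.
Proof on paper: `per_m` is polystable (BurgisserIkenmeyer2017 Cor. 2.9 / Kempf–Ness criticality),
`dim Stab_{GL_{m²}}(per_m) = 2m − 2 < m² − 1 ≤ dim Stab(tr X^m)` (Marcus–May; GIP17 Thm 7; checked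
by exact Lie-algebra computation for m = 3,4 in sanity/stabdim.py), and a polystable point in an orbit
closure has stabiliser dimension ≥ that of the orbit's point (closed-orbit lemma). -/
def PolystableOrbitRung : Prop :=
  ∀ m : ℕ, 3 ≤ m → perPoly (Fin m) ℂ ∉ orbitClosure (powTraceSame m)

/-- FIRST LEMMA (A2, slot form = the `e = 0` slice of K1 for EVERY `m ≥ 3`): by Theorem A's
(elementary: polarisation + rank-one) completeness direction, A1 gives a multiplicity `t` with
`1_OF(t,m) ∉ span_m(t,m)`. For `m = 3` this is literally the route's support item
`BorderPcPerThree` (stmt-ValiantsHypothesis-16085), which the line therefore settles on paper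
(border trace-power complexity of per_3 ≥ 4) without the planned 1.9·10⁸-partition enumeration. -/
def PolystableRung : Prop := ∀ m : ℕ, 3 ≤ m → ∃ t : ℕ, Sep t m m

theorem borderPcPerThree_of_polystableRung (h : PolystableRung) : BorderPcPerThree := by
  obtain ⟨t, ht⟩ := h 3 le_rfl
  exact ⟨t, ht⟩

/-- TRANSFER C⁺ of idea A (`InvariantDetection`): K1 with the certificate confined to the single
invariant isotypic type `(t^{m²})` — an `SL_{m²}`-invariant polynomial `F` in the coefficients of
`m`-forms vanishing on every width-`(m+e)` trace power and not at `per_m`. Given polystability of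
`per_m` (BI17 Cor 2.9) and Mumford separation of disjoint closed `SL`-stable sets, C⁺ ⟺ K1; the
invariance clause is spelled exactly as in route UnpaddedGIT. -/
def InvariantDetection : Prop :=
  ∀ c m₀ : ℕ, ∃ m : ℕ, m₀ ≤ m ∧ 1 ≤ m ∧ ∀ e : ℕ, m + e ≤ 2 ^ ((Nat.log 2 m + c) ^ c) →
    ∃ F : MvPolynomial ((Fin m × Fin m) →₀ ℕ) ℂ,
      (∀ (g : Matrix.SpecialLinearGroup (Fin m × Fin m) ℂ) (f : MvPolynomial (Fin m × Fin m) ℂ),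
          f.IsHomogeneous m →
          MvPolynomial.aeval (coeffVec (linSubst (Fin m × Fin m) ℂ
            (g : Matrix (Fin m × Fin m) (Fin m × Fin m) ℂ) f)) F
            = MvPolynomial.aeval (coeffVec f) F) ∧
      (∀ A : Matrix (Fin (m + e)) (Fin (m + e)) (MvPolynomial (Fin m × Fin m) ℂ),
          (∀ i j, (A i j).IsHomogeneous 1) →
          MvPolynomial.aeval (coeffVec ((A ^ m).trace)) F = 0) ∧
      MvPolynomial.aeval (coeffVec (perPoly (Fin m) ℂ)) F ≠ 0

/-! ## Idea B (`cell-povm-leakage-gap`) — first lemma: the Rayleigh–gap certificate -/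

/-- FIRST LEMMA (B1, abstract form): a vector whose Rayleigh quotient for a positive semidefinite
kernel lies below every nonzero eigenvalue is not in the kernel's range. Instantiated with the
route's integer kernel `K_n(π,π') = Σ_{σ∼π,σ'∼π'} n^{cyc(σ⁻¹σ')}` (range `K_n = span_n(t,m)`) and
`v = 1_OF(t,m)` it reads: `⟨1_OF, K_n 1_OF⟩ < γ_min(K_n) · #OF(t,m) ⟹ Sep t m n`, where the left side
is `#OF · Σ_ρ A_T(ρ) n^{cyc ρ}` — the Ewens(θ = n) partition function of the Cayley-distance
distribution of the 1-factorisation permutation code `T`. -/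
theorem gap_certificate {N : Type*} [Fintype N] [DecidableEq N]
    (K : Matrix N N ℝ) (hK : K.PosSemidef) (γ : ℝ) (v : N → ℝ)
    (hγ : ∀ μ : ℝ, Module.End.HasEigenvalue (Matrix.toLin' K) μ → μ ≠ 0 → γ ≤ μ)
    (hv : v ⬝ᵥ (K.mulVec v) < γ * (v ⬝ᵥ v)) :
    v ∉ LinearMap.range (Matrix.toLin' K) := by
  sorry

/-! ## The `e = 1` rung (calibration; idea C `fixed-apolar-witness-pow` was NOT filed) -/

/-- `RungOne`: separation one step into the window infinitely often (`border pc(per_m) ≥ m + 2` i.o.).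
STATUS after this session's compute (kit j025221/j025295): its `m = 3` instance `RungOneAtThree` is
FALSE — `per_3 = tr(A³)` for an explicit (numerically verified, even traceless) `A ∈ M_4(linear forms)`,
so `1_OF(t,3) ∈ span_4(t,3)` for every `t` and `pc(per_3) = pc̲(per_3) = 4` (lower bound = idea A).
The first open instance is `m = 4`, `n = 5` (kit j025319 scanning exact widths of per_4). -/
def RungOne : Prop := ∀ m₀ : ℕ, ∃ m : ℕ, m₀ ≤ m ∧ ∃ t : ℕ, Sep t m (m + 1)

/-- numerically REFUTED (per_3 ∈ X_4(3) exactly); kept as the record of the closed m = 3 ladder. -/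
def RungOneAtThree : Prop := ∃ t : ℕ, Sep t 3 4

end Summit.ValiantsHypothesis.ValiantsHypothesis.Cruxes.OneFactorisationBandLimit.IdeasR1K1
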